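import Summits.CriticalPhenomena.PercolationContinuityZ3.Theorems.PercNearOneGluingAdditiveGluingFingerPeelPair
import Summits.CriticalPhenomena.PercolationContinuityZ3.Theorems.PercNearOneGluingAdditiveGluingAL5TwoRelaysTools
import HarnessLib

/-! # Crux `PercNearOneGluing.AdditiveGluing` (stmt-CriticalPhenomena-4576) — the finger multi-edge Lemma 3 (`stub_fingerML3_vp`):
# LEAF STRIPPING, and the class "one hub + single-contact leaves" (seat (b) V⁺-form, depth prover `png-dp-vplus`, gen 8)

Support file (`--supports stmt-CriticalPhenomena-4576`); no definitions, no named facts, no sorries.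

Setting of `stub_fingerML3_vp`: a weighting `K` on `Fin n`, relays `A ∋ b, d`, a block `N` (`Disjoint N A`, every positive-weight pair at
`N` goes to `A` or stays inside `N`), `g = K/N` the glued weighting (`1` on the non-loop pairs inside `N`), `R` = "some pair `N–A` is open",
conclusion FML3(K): `μ_g(R ∩ {d↔b}) ≤ μ_g(R ∩ ⋃_{v∈N}{v↔b})`, hypothesis `μ_K(d↔b) ≤ μ_K(a↔b)` for every `a ∈ A` (UNGLUED).

A LEAF of the block is a vertex `ℓ ∈ N` with at most one positive-weight pair, `s(ℓ, c)` with `c ∈ A` (no inner pairs at `ℓ`).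
Memo MEMO-gen8 (run/shared/lean/prim/prim-png-dp-vplus/) §3: conditioning on the leaf pair, the stub's margin is
`(1 − k)·margin(K ⊖ s(ℓ,c)) + k·[μ_{K'}(N ∪ {c} ↔ b) − μ_{K'/(N∪{c})}(d ↔ b)]` and the bracket is `≥ 0` by ONE application of Kozma–Nitzan
Lemma 3(ii) (the unglued hypothesis at the single relay `c`).  In the tree this is exactly `fingerML3_peel_pair` (gen 6); the new point is that
for a LEAF pair the hypothesis of the stub TRANSFERS to the peeled weighting (`al5_pendant_real_openConn`: deleting the only pair of a pendant
vertex does not change any `μ(x↔b)`, `x ≠ ℓ`), so the peeling inducts: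

* `fingerML3_peel_pair_self` — the companion of `fingerML3_peel_pair` for a pair `s(f, d)` at the comparison vertex `d` itself (there the
  exchange is pointwise: on "`s(f,d)` open", `d ↔ b` forces `f ↔ b`).
* `reachable_of_glue_inertLeaves`, `real_openConn_glue_eq_of_inertLeaves` — if every vertex of `N` other than the hub `ν` is INERT in `K`
  (all its non-loop pairs have weight `0`), gluing `N` does not change `μ(x ↔ b)` for `x, b ∉ N` (a walk of the glued configuration is
  projected onto the unglued one by sending the block to `ν`).
* `fingerML3_hub_inert` — FML3 for a block "hub + inert vertices" (Kozma–Nitzan Thm 4 / `fingerML3_of_gluedWitness` with the base-weakest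
  relay as witness; the glued comparison is the unglued one by the locality lemma).
* `fingerML3_hub_leaves` — **`stub_fingerML3_vp` for every block consisting of one hub `ν` (arbitrary contacts) and any number of
  single-contact leaves, for EVERY relay set `A`**: induction on the number of positive leaf pairs (`fingerML3_peel_pair` /
  `fingerML3_peel_pair_self` + hypothesis transfer), base `fingerML3_hub_inert`.
This class lies inside the open configuration family of the crux ("≥ 3 contact relays, ≥ 2 base-weak", e.g. touch patterns `[{1,2,3},{3}]`,
`[{1,2},{3}]`, `[{1,2,3},{1},{2}]`) and is disjoint from the landed ones (`|A| ≤ 3`; `|A| ≤ 4` without `b`-fingers; fingers touching `≤ 2`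
relays).  Depth-prover numerics (lab/s11.py): identity and the sign of the bracket verified exactly on 288 random systems (0 failures).
[cite: KozmaNitzan2024, Lemma 3(i)–(ii) (pp. 6–7), Lemma 5 and Thm 4 (§3.2, pp. 12–14)]
-/

namespace Summit.CriticalPhenomena.PercolationContinuityZ3.Theorems

open MeasureTheory Set
open Literature.Probability.LatticeModels (prodBernoulli)
open Literature.Probability.Percolation (BondConfig openConn openGraph pinW)

noncomputable section
open Classical

section FingerLeaves

open Literature.Probability.LatticeModels Literature.Probability.Percolation

variable {n : ℕ}

/-! ### Peeling a pair at the comparison vertex `d` itself -/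

/-- **Peeling pairs at `d`.**  `g` any weighting, block `N`, `F₁` arbitrary further contact pairs, `F_d` pairs `s(v, d)` with `v ∈ N`
(`d ∉ N`), `U = ⋃_{s∈N}{s↔b}`.  If the multi-edge conclusion holds for `F₁` in the weighting `pinW g F_d ∅` (pairs of `F_d` killed), then it
holds for `F₁ ∪ F_d` in `g`: on "some pair of `F_d` open" the vertex `d` is adjacent to the block, so `{d↔b} ⊆ U` there (`contact_split`).
[cite: KozmaNitzan2024, §3.2 pp. 12–14] -/
theorem block_multiEdge_peel_self (g : Sym2 (Fin n) → unitInterval) (N : Finset (Fin n)) (F₁ Fd : Finset (Sym2 (Fin n)))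
    (d b : Fin n) (hFd : ∀ e ∈ Fd, ∃ v ∈ N, e = s(v, d)) (hdN : d ∉ N)
    (hii : (prodBernoulli (pinW g (↑Fd : Set (Sym2 (Fin n))) (∅ : Set (Sym2 (Fin n))))).real
        ({ω : Set (Sym2 (Fin n)) | ∃ e ∈ F₁, e ∈ ω} ∩ openConn d b) ≤
      (prodBernoulli (pinW g (↑Fd : Set (Sym2 (Fin n))) (∅ : Set (Sym2 (Fin n))))).real
        ({ω : Set (Sym2 (Fin n)) | ∃ e ∈ F₁, e ∈ ω} ∩ ⋃ s ∈ N, openConn s b)) :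
    (prodBernoulli g).real ({ω : Set (Sym2 (Fin n)) | ∃ e ∈ F₁ ∪ Fd, e ∈ ω} ∩ openConn d b) ≤
      (prodBernoulli g).real ({ω : Set (Sym2 (Fin n)) | ∃ e ∈ F₁ ∪ Fd, e ∈ ω} ∩ ⋃ s ∈ N, openConn s b) := by
  -- on `R_d` = "some pair of `F_d` open", `d ↔ b` forces `v ↔ b` for the block vertex `v` of that pair
  have hB : (prodBernoulli g).real ({ω : Set (Sym2 (Fin n)) | ∃ e ∈ Fd, e ∈ ω} ∩ openConn d b) ≤
      (prodBernoulli g).real ({ω : Set (Sym2 (Fin n)) | ∃ e ∈ Fd, e ∈ ω} ∩ ⋃ s ∈ N, openConn s b) := by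
    refine measureReal_mono ?_ (measure_ne_top _ _)
    rintro ω ⟨⟨e, he, heω⟩, hdb⟩
    refine ⟨⟨e, he, heω⟩, ?_⟩
    obtain ⟨v, hv, rfl⟩ := hFd e he
    have hvd : v ≠ d := fun h => hdN (h ▸ hv)
    have hadj : (openGraph ω).Adj v d := (openGraph_adj ω v d).2 ⟨heω, hvd⟩
    simp only [Set.mem_iUnion, exists_prop]
    exact ⟨v, hv, hadj.reachable.trans hdb⟩
  rw [Finset.union_comm F₁ Fd, contact_split g Fd F₁ (openConn d b), contact_split g Fd F₁ (⋃ s ∈ N, openConn s b)]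
  have hC0 : 0 ≤ (prodBernoulli g).real ({ω : Set (Sym2 (Fin n)) | ∃ e ∈ Fd, e ∈ ω}ᶜ : Set (BondConfig (Fin n))) :=
    measureReal_nonneg
  have hm := mul_le_mul_of_nonneg_left hii hC0
  linarith

/-- **Peeling one finger–`d` pair.**  Stub setting with `d ∈ A`, `f ∈ N`.  If the conclusion of `stub_fingerML3_vp` holds for the relay set
`A` in the weighting `K ⊖ s(f,d)` (the pair `s(f,d)` killed), then it holds for `A` in `K` — no hypothesis is needed at `d`
(`block_multiEdge_peel_self` with the one-pair family `{s(f,d)}`). [cite: KozmaNitzan2024, §3.2 pp. 12–14] -/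
theorem fingerML3_peel_pair_self (K : Sym2 (Fin n) → unitInterval) (A N : Finset (Fin n)) (d b f : Fin n)
    (hNA : Disjoint N A) (hd : d ∈ A) (hf : f ∈ N)
    (hsub : (prodBernoulli (fun e' : Sym2 (Fin n) => if (∀ y ∈ e', y ∈ N) ∧ ¬ e'.IsDiag then 1 else
              if e' = s(f, d) then (0 : unitInterval) else K e')).real
          ({ω : Set (Sym2 (Fin n)) | ∃ v ∈ N, ∃ a' ∈ A, s(v, a') ∈ ω} ∩ openConn d b) ≤
        (prodBernoulli (fun e' : Sym2 (Fin n) => if (∀ y ∈ e', y ∈ N) ∧ ¬ e'.IsDiag then 1 else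
              if e' = s(f, d) then (0 : unitInterval) else K e')).real
          ({ω : Set (Sym2 (Fin n)) | ∃ v ∈ N, ∃ a' ∈ A, s(v, a') ∈ ω} ∩ ⋃ v ∈ N, openConn v b)) :
    (prodBernoulli (fun e' : Sym2 (Fin n) => if (∀ y ∈ e', y ∈ N) ∧ ¬ e'.IsDiag then 1 else K e')).real
        ({ω : Set (Sym2 (Fin n)) | ∃ v ∈ N, ∃ a' ∈ A, s(v, a') ∈ ω} ∩ openConn d b) ≤
      (prodBernoulli (fun e' : Sym2 (Fin n) => if (∀ y ∈ e', y ∈ N) ∧ ¬ e'.IsDiag then 1 else K e')).real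
        ({ω : Set (Sym2 (Fin n)) | ∃ v ∈ N, ∃ a' ∈ A, s(v, a') ∈ ω} ∩ ⋃ v ∈ N, openConn v b) := by
  set g : Sym2 (Fin n) → unitInterval := fun e' => if (∀ y ∈ e', y ∈ N) ∧ ¬ e'.IsDiag then 1 else K e' with hg
  set g' : Sym2 (Fin n) → unitInterval := fun e' => if (∀ y ∈ e', y ∈ N) ∧ ¬ e'.IsDiag then 1 else
      if e' = s(f, d) then (0 : unitInterval) else K e' with hg'
  set Fa : Finset (Sym2 (Fin n)) := {s(f, d)} with hFadef
  set Fall : Finset (Sym2 (Fin n)) := (N ×ˢ A).image (fun va : Fin n × Fin n => s(va.1, va.2)) with hFalldef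
  set F₁ : Finset (Sym2 (Fin n)) := Fall.erase s(f, d) with hF₁def
  have hdN : d ∉ N := Finset.disjoint_left.1 hNA.symm hd
  have hFa : ∀ e ∈ Fa, ∃ v ∈ N, e = s(v, d) := by
    intro e he
    rw [hFadef, Finset.mem_singleton] at he
    exact ⟨f, hf, he⟩
  have hmemall : s(f, d) ∈ Fall := Finset.mem_image.2 ⟨(f, d), Finset.mem_product.2 ⟨hf, hd⟩, rfl⟩
  have hunion : F₁ ∪ Fa = Fall := by
    rw [hF₁def, hFadef, Finset.union_comm, ← Finset.insert_eq]
    exact Finset.insert_erase hmemall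
  have hinsert : insert s(f, d) F₁ = Fall := by rw [hF₁def]; exact Finset.insert_erase hmemall
  have hpin : pinW g (↑Fa : Set (Sym2 (Fin n))) (∅ : Set (Sym2 (Fin n))) = g' := by
    rw [hg, hg', hFadef]; exact fingerPeelPair_pinW_glue_eq K N hdN
  -- the killed pair has weight 0 in `g'`
  have h0 : (g' s(f, d) : ℝ) = 0 := by
    have h1 : ¬ ((∀ y ∈ s(f, d), y ∈ N) ∧ ¬ (s(f, d)).IsDiag) := fun h => hdN (h.1 d (Sym2.mem_mk_right f d))
    simp only [hg', h1, if_false, if_true]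
    rfl
  have hii : (prodBernoulli (pinW g (↑Fa : Set (Sym2 (Fin n))) (∅ : Set (Sym2 (Fin n))))).real
        ({ω : Set (Sym2 (Fin n)) | ∃ e ∈ F₁, e ∈ ω} ∩ openConn d b) ≤
      (prodBernoulli (pinW g (↑Fa : Set (Sym2 (Fin n))) (∅ : Set (Sym2 (Fin n))))).real
        ({ω : Set (Sym2 (Fin n)) | ∃ e ∈ F₁, e ∈ ω} ∩ ⋃ s ∈ N, openConn s b) := by
    rw [hpin, ← contact_event_erase_null_pair g' F₁ s(f, d) h0, ← contact_event_erase_null_pair g' F₁ s(f, d) h0, hinsert,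
      hFalldef, ← fingerContact_R_eq N A]
    exact hsub
  rw [fingerContact_R_eq N A, ← hFalldef, ← hunion]
  exact block_multiEdge_peel_self g N F₁ Fa d b hFa hdN hii

/-! ### Gluing a block whose non-hub vertices are inert does not change two-point functions off the block -/

/-- **Projection of a glued walk.**  If every vertex of `N` other than `ν ∈ N` is isolated in `ω`, then a walk of the GLUED configuration
`ω ∪ clique(N)` between vertices outside `N ∖ {ν}` projects to a walk of `ω` (send the whole block to `ν`): its `ω`-edges avoid `N ∖ {ν}` and its
clique edges become trivial. [folklore] -/
theorem reachable_of_glue_inertLeaves {ω : BondConfig (Fin n)} {N : Finset (Fin n)} {ν : Fin n} (hν : ν ∈ N)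
    (hiso : ∀ ℓ ∈ N, ℓ ≠ ν → ∀ y : Fin n, y ≠ ℓ → s(ℓ, y) ∉ ω) {x y : Fin n}
    (hx : x ∉ N ∨ x = ν) (hy : y ∉ N ∨ y = ν)
    (h : (openGraph (ω ∪ {e : Sym2 (Fin n) | (∀ z ∈ e, z ∈ N) ∧ ¬ e.IsDiag} : BondConfig (Fin n))).Reachable x y) :
    (openGraph ω).Reachable x y := by
  -- the projection `φ` sending the block to its hub
  let φ : Fin n → Fin n := fun v => if v ∈ N then ν else v
  have hφ_out : ∀ v : Fin n, (v ∉ N ∨ v = ν) → φ v = v := by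
    intro v hv
    rcases hv with hv | rfl
    · simp only [φ, hv, if_false]
    · simp only [φ, hν, if_true]
  -- a vertex carrying an `ω`-edge is outside `N ∖ {ν}`
  have hcarrier : ∀ u w : Fin n, s(u, w) ∈ ω → u ≠ w → (u ∉ N ∨ u = ν) := by
    intro u w huw hne
    by_cases huN : u ∈ N
    · by_cases huν : u = ν
      · exact Or.inr huν
      · exact (hiso u huN huν w (Ne.symm hne) huw).elim
    · exact Or.inl huN
  obtain ⟨p⟩ := h
  suffices key : ∀ (u v : Fin n)
      (q : (openGraph (ω ∪ {e : Sym2 (Fin n) | (∀ z ∈ e, z ∈ N) ∧ ¬ e.IsDiag} : BondConfig (Fin n))).Walk u v),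
      (openGraph ω).Reachable (φ u) (φ v) by
    have := key x y p
    rwa [hφ_out x hx, hφ_out y hy] at this
  intro u v q
  induction q with
  | nil => exact SimpleGraph.Reachable.refl _
  | cons hadj q ih =>
    rename_i u' w' _
    refine SimpleGraph.Reachable.trans ?_ ih
    obtain ⟨hmem, hne⟩ := (openGraph_adj _ u' w').1 hadj
    rcases hmem with hω | hD
    · -- an `ω`-edge: both ends are outside `N ∖ {ν}`, so `φ` fixes them
      have hu := hcarrier u' w' hω hne
      have hw := hcarrier w' u' (by rw [Sym2.eq_swap]; exact hω) hne.symm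
      rw [hφ_out u' hu, hφ_out w' hw]
      exact ((openGraph_adj ω u' w').2 ⟨hω, hne⟩).reachable
    · -- a clique edge: both ends are in `N`, both project to `ν`
      have hu : u' ∈ N := hD.1 u' (Sym2.mem_mk_left u' w')
      have hw : w' ∈ N := hD.1 w' (Sym2.mem_mk_right u' w')
      have h1 : φ u' = ν := by simp only [φ, hu, if_true]
      have h2 : φ w' = ν := by simp only [φ, hw, if_true]
      rw [h1, h2]

/-- **Locality: gluing a hub with inert satellites.**  If every vertex `ℓ ≠ ν` of the block `N ∋ ν` is inert in `K` (all pairs `s(ℓ, y)`,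
`y ≠ ℓ`, have weight `0`), then `μ_{K/N}(x ↔ b) = μ_K(x ↔ b)` for all `x, b ∉ N`: by the gluing push-forward (`stub_gluePushforward`)
the left side is `μ_K(x ↔ b` in `ω ∪ clique(N))`, and almost surely the satellites are isolated, where `reachable_of_glue_inertLeaves` applies.
[cite: KozmaNitzan2024, §3.1 (gluing = probability 1)] -/
theorem real_openConn_glue_eq_of_inertLeaves (K : Sym2 (Fin n) → unitInterval) (N : Finset (Fin n)) (ν : Fin n) (hν : ν ∈ N)
    (hinert : ∀ ℓ ∈ N, ℓ ≠ ν → ∀ y : Fin n, y ≠ ℓ → K s(ℓ, y) = 0) (x b : Fin n) (hx : x ∉ N) (hb : b ∉ N) :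
    (prodBernoulli (fun e' : Sym2 (Fin n) => if (∀ y ∈ e', y ∈ N) ∧ ¬ e'.IsDiag then 1 else K e')).real (openConn x b) =
      (prodBernoulli K).real (openConn x b) := by
  rw [stub_gluePushforward n K N (openConn x b)]
  -- almost surely the satellites are isolated
  have hae : ∀ᵐ ω ∂prodBernoulli K, ∀ ℓ : Fin n, ∀ y : Fin n, ℓ ∈ N → ℓ ≠ ν → y ≠ ℓ → s(ℓ, y) ∉ ω := by
    refine ae_all_iff.2 fun ℓ => ae_all_iff.2 fun y => ?_
    by_cases hℓ : ℓ ∈ N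
    · by_cases hℓν : ℓ = ν
      · exact Filter.Eventually.of_forall fun ω _ h => absurd hℓν h
      · by_cases hyℓ : y = ℓ
        · exact Filter.Eventually.of_forall fun ω _ _ h => absurd hyℓ h
        · filter_upwards [prodBernoulli_ae_notMem K (hinert ℓ hℓ hℓν y hyℓ)] with ω hω using fun _ _ _ => hω
    · exact Filter.Eventually.of_forall fun ω h => absurd h hℓ
  refine measureReal_congr ?_
  filter_upwards [hae] with ω hω
  have hiso : ∀ ℓ ∈ N, ℓ ≠ ν → ∀ y : Fin n, y ≠ ℓ → s(ℓ, y) ∉ ω := fun ℓ hℓ hℓν y hy => hω ℓ y hℓ hℓν hy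
  refine propext ⟨fun h => ?_, fun h => ?_⟩
  · exact reachable_of_glue_inertLeaves hν hiso (Or.inl hx) (Or.inl hb) h
  · exact reachable_glue_mono N (show (openGraph ω).Reachable x b from h)

/-! ### The base case: a hub with inert satellites -/

/-- **FML3 for a block "hub + inert satellites".**  Stub setting (`b, d ∈ A`, `Disjoint N A`, fingers free off `A`, `d` unglued-weakest
over `A`); if every vertex of `N` other than `ν` is inert, then `μ_{K/N}(R ∩ {d↔b}) ≤ μ_{K/N}(R ∩ ⋃_{v∈N}{v↔b})`.  Proof: with `a₀ ∈ A`
minimising the base reliability `μ_q(· ↔ b)` (`q` = `K` with the pairs at `N` killed), `fingerML3_of_gluedWitness` needs only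
`μ_{K/N}(d↔b) ≤ μ_{K/N}(a₀↔b)`, which is the unglued hypothesis at `a₀` by `real_openConn_glue_eq_of_inertLeaves`.  (This is
Kozma–Nitzan's Theorem 4 for the hub.) [cite: KozmaNitzan2024, Thm 4 and Lemma 5 (§3.2, pp. 12–14)] -/
theorem fingerML3_hub_inert (K : Sym2 (Fin n) → unitInterval) (A N : Finset (Fin n)) (d b ν : Fin n)
    (hb : b ∈ A) (hNA : Disjoint N A) (hd : d ∈ A) (hν : ν ∈ N)
    (hfree : ∀ v ∈ N, ∀ y : Fin n, y ∉ A → y ∉ N → (K s(v, y) : ℝ) = 0)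
    (hinert : ∀ ℓ ∈ N, ℓ ≠ ν → ∀ y : Fin n, y ≠ ℓ → K s(ℓ, y) = 0)
    (hle : ∀ a ∈ A, (prodBernoulli K).real (openConn d b) ≤ (prodBernoulli K).real (openConn a b)) :
    (prodBernoulli (fun e' : Sym2 (Fin n) => if (∀ y ∈ e', y ∈ N) ∧ ¬ e'.IsDiag then 1 else K e')).real
        ({ω : Set (Sym2 (Fin n)) | ∃ v ∈ N, ∃ a' ∈ A, s(v, a') ∈ ω} ∩ openConn d b) ≤
      (prodBernoulli (fun e' : Sym2 (Fin n) => if (∀ y ∈ e', y ∈ N) ∧ ¬ e'.IsDiag then 1 else K e')).real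
        ({ω : Set (Sym2 (Fin n)) | ∃ v ∈ N, ∃ a' ∈ A, s(v, a') ∈ ω} ∩ ⋃ v ∈ N, openConn v b) := by
  set q : Sym2 (Fin n) → unitInterval := fun e' => if (∃ y ∈ e', y ∈ N) then (0 : unitInterval) else K e' with hq
  obtain ⟨a₀, ha₀, hmin⟩ := A.exists_min_image (fun a => (prodBernoulli q).real (openConn a b)) ⟨b, hb⟩
  have ha₀N : a₀ ∉ N := Finset.disjoint_left.1 hNA.symm ha₀
  have hdN : d ∉ N := Finset.disjoint_left.1 hNA.symm hd
  have hbN : b ∉ N := Finset.disjoint_left.1 hNA.symm hb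
  refine fingerML3_of_gluedWitness K A N d a₀ b hNA ha₀N hfree (fun a ha => hmin a ha) ?_
  rw [real_openConn_glue_eq_of_inertLeaves K N ν hν hinert d b hdN hbN,
    real_openConn_glue_eq_of_inertLeaves K N ν hν hinert a₀ b ha₀N hbN]
  exact hle a₀ ha₀

/-! ### The class "one hub + single-contact leaves" -/

/-- **`stub_fingerML3_vp` for a hub with leaves.**  Stub setting (`b, d ∈ A`, block `N` disjoint from `A`, fingers free off `A`,
`μ_K(d↔b) ≤ μ_K(a↔b)` for all `a ∈ A`).  Suppose `N` contains a hub `ν` and every other vertex `ℓ ∈ N` is a LEAF: for some relay `c ∈ A`,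
every pair `s(ℓ, y)` with `y ∉ {c, ℓ}` has weight `0` (so `ℓ` touches at most the single relay `c`, and has no inner pairs).  Then
`μ_{K/N}(R ∩ {d↔b}) ≤ μ_{K/N}(R ∩ ⋃_{v∈N}{v↔b})` — for EVERY relay set `A`.
Proof: induction on the number of leaf pairs of positive weight.  Peel one, `s(ℓ, c)`: the conclusion for `K` follows from the conclusion
for `K ⊖ s(ℓ,c)` by `fingerML3_peel_pair` (hypothesis at `c`, Kozma–Nitzan Lemma 3(ii)) or, if `c = d`, by `fingerML3_peel_pair_self`;
and the stub's hypothesis holds for `K ⊖ s(ℓ,c)` because deleting the only pair of a pendant vertex changes no `μ(x↔b)`, `x ≠ ℓ`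
(`al5_pendant_real_openConn`).  Base: `fingerML3_hub_inert`.
[cite: KozmaNitzan2024, Lemma 3(ii) (pp. 6–7), Lemma 5 and Thm 4 (§3.2, pp. 12–14)] -/
theorem fingerML3_hub_leaves (K : Sym2 (Fin n) → unitInterval) (A N : Finset (Fin n)) (d b ν : Fin n)
    (hb : b ∈ A) (hNA : Disjoint N A) (hd : d ∈ A) (hν : ν ∈ N)
    (hfree : ∀ v ∈ N, ∀ y : Fin n, y ∉ A → y ∉ N → (K s(v, y) : ℝ) = 0)
    (hleaf : ∀ ℓ ∈ N, ℓ ≠ ν → ∃ c ∈ A, ∀ y : Fin n, y ≠ c → y ≠ ℓ → K s(ℓ, y) = 0)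
    (hle : ∀ a ∈ A, (prodBernoulli K).real (openConn d b) ≤ (prodBernoulli K).real (openConn a b)) :
    (prodBernoulli (fun e' : Sym2 (Fin n) => if (∀ y ∈ e', y ∈ N) ∧ ¬ e'.IsDiag then 1 else K e')).real
        ({ω : Set (Sym2 (Fin n)) | ∃ v ∈ N, ∃ a' ∈ A, s(v, a') ∈ ω} ∩ openConn d b) ≤
      (prodBernoulli (fun e' : Sym2 (Fin n) => if (∀ y ∈ e', y ∈ N) ∧ ¬ e'.IsDiag then 1 else K e')).real
        ({ω : Set (Sym2 (Fin n)) | ∃ v ∈ N, ∃ a' ∈ A, s(v, a') ∈ ω} ∩ ⋃ v ∈ N, openConn v b) := by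
  -- the set of positive leaf pairs, as a function of the weighting
  let P : (Sym2 (Fin n) → unitInterval) → Finset (Fin n × Fin n) := fun w =>
    ((N.erase ν) ×ˢ A).filter (fun la => w s(la.1, la.2) ≠ 0)
  -- induction on its cardinality, for all weightings with the structural hypotheses
  suffices key : ∀ (m : ℕ) (w : Sym2 (Fin n) → unitInterval), (P w).card = m →
      (∀ v ∈ N, ∀ y : Fin n, y ∉ A → y ∉ N → (w s(v, y) : ℝ) = 0) →
      (∀ ℓ ∈ N, ℓ ≠ ν → ∃ c ∈ A, ∀ y : Fin n, y ≠ c → y ≠ ℓ → w s(ℓ, y) = 0) →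
      (∀ a ∈ A, (prodBernoulli w).real (openConn d b) ≤ (prodBernoulli w).real (openConn a b)) →
      (prodBernoulli (fun e' : Sym2 (Fin n) => if (∀ y ∈ e', y ∈ N) ∧ ¬ e'.IsDiag then 1 else w e')).real
          ({ω : Set (Sym2 (Fin n)) | ∃ v ∈ N, ∃ a' ∈ A, s(v, a') ∈ ω} ∩ openConn d b) ≤
        (prodBernoulli (fun e' : Sym2 (Fin n) => if (∀ y ∈ e', y ∈ N) ∧ ¬ e'.IsDiag then 1 else w e')).real
          ({ω : Set (Sym2 (Fin n)) | ∃ v ∈ N, ∃ a' ∈ A, s(v, a') ∈ ω} ∩ ⋃ v ∈ N, openConn v b) from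
    key _ K rfl hfree hleaf hle
  have hdN : d ∉ N := Finset.disjoint_left.1 hNA.symm hd
  have hbN : b ∉ N := Finset.disjoint_left.1 hNA.symm hb
  intro m
  induction m using Nat.strong_induction_on with
  | _ m ih =>
    intro w hcard wfree wleaf wle
    by_cases hP : P w = ∅
    · -- base: every satellite is inert
      refine fingerML3_hub_inert w A N d b ν hb hNA hd hν wfree ?_ wle
      intro ℓ hℓ hℓν y hyℓ
      obtain ⟨c, hc, hcw⟩ := wleaf ℓ hℓ hℓν
      by_cases hyc : y = c
      · subst hyc
        by_contra hne
        have : (ℓ, y) ∈ P w := Finset.mem_filter.2 ⟨Finset.mem_product.2 ⟨Finset.mem_erase.2 ⟨hℓν, hℓ⟩, hc⟩, hne⟩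
        rw [hP] at this
        exact Finset.notMem_empty _ this
      · exact hcw y hyc hyℓ
    · -- step: peel one positive leaf pair `s(ℓ, c)`
      obtain ⟨⟨ℓ, c⟩, hℓc⟩ := Finset.nonempty_iff_ne_empty.2 hP
      obtain ⟨hℓcA, hwℓc⟩ := Finset.mem_filter.1 hℓc
      obtain ⟨hℓ', hc⟩ := Finset.mem_product.1 hℓcA
      obtain ⟨hℓν, hℓ⟩ := Finset.mem_erase.1 hℓ'
      simp only at hwℓc hc hℓν hℓ
      have hcN : c ∉ N := Finset.disjoint_left.1 hNA.symm hc
      have hcℓ : c ≠ ℓ := fun h => hcN (h ▸ hℓ)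
      -- `c` is THE contact of the leaf `ℓ`
      obtain ⟨c', hc', hcw'⟩ := wleaf ℓ hℓ hℓν
      have hcc' : c = c' := by
        by_contra hne
        exact hwℓc (hcw' c hne hcℓ)
      have hℓpend : ∀ u : Fin n, u ≠ ℓ → u ≠ c → w s(ℓ, u) = 0 := fun u hu huc => hcw' u (hcc' ▸ huc) hu
      -- the peeled weighting
      set w' : Sym2 (Fin n) → unitInterval := fun e' => if e' = s(ℓ, c) then 0 else w e' with hw'
      have hw'le : ∀ e : Sym2 (Fin n), w' e = 0 ∨ w' e = w e := by
        intro e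
        by_cases he : e = s(ℓ, c)
        · left; simp only [hw', he, if_true]
        · right; simp only [hw', he, if_false]
      -- two-point functions of vertices `≠ ℓ` are unchanged
      have htwo : ∀ v : Fin n, v ≠ ℓ → (prodBernoulli w').real (openConn v b) = (prodBernoulli w).real (openConn v b) := by
        intro v hv
        rw [hw']
        exact (al5_pendant_real_openConn w ℓ c v b hv (fun h => hbN (h ▸ hℓ)) hcℓ hℓpend).symm
      -- the structural hypotheses for `w'`
      have w'free : ∀ v ∈ N, ∀ y : Fin n, y ∉ A → y ∉ N → (w' s(v, y) : ℝ) = 0 := by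
        intro v hv y hyA hyN
        rcases hw'le s(v, y) with h | h
        · rw [h]; rfl
        · rw [h]; exact wfree v hv y hyA hyN
      have w'leaf : ∀ ℓ₁ ∈ N, ℓ₁ ≠ ν → ∃ c₁ ∈ A, ∀ y : Fin n, y ≠ c₁ → y ≠ ℓ₁ → w' s(ℓ₁, y) = 0 := by
        intro ℓ₁ hℓ₁ hℓ₁ν
        obtain ⟨c₁, hc₁, hcw₁⟩ := wleaf ℓ₁ hℓ₁ hℓ₁ν
        refine ⟨c₁, hc₁, fun y hy hyℓ => ?_⟩
        rcases hw'le s(ℓ₁, y) with h | h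
        · exact h
        · rw [h]; exact hcw₁ y hy hyℓ
      have w'le : ∀ a ∈ A, (prodBernoulli w').real (openConn d b) ≤ (prodBernoulli w').real (openConn a b) := by
        intro a ha
        rw [htwo d (fun h => hdN (h ▸ hℓ)), htwo a (fun h => (Finset.disjoint_left.1 hNA.symm ha) (h ▸ hℓ))]
        exact wle a ha
      -- the positive leaf pairs of `w'` are those of `w` minus `(ℓ, c)`
      have hPsub : P w' ⊆ (P w).erase (ℓ, c) := by
        intro la hla
        obtain ⟨hlaA, hwla⟩ := Finset.mem_filter.1 hla
        refine Finset.mem_erase.2 ⟨?_, Finset.mem_filter.2 ⟨hlaA, ?_⟩⟩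
        · rintro rfl
          exact hwla (by simp only [hw', if_true])
        · rcases hw'le s(la.1, la.2) with h | h
          · exact (hwla h).elim
          · rwa [h] at hwla
      have hcard' : (P w').card < m := by
        calc (P w').card ≤ ((P w).erase (ℓ, c)).card := Finset.card_le_card hPsub
          _ < (P w).card := Finset.card_erase_lt_of_mem hℓc
          _ = m := hcard
      have hsub := ih (P w').card hcard' w' rfl w'free w'leaf w'le
      -- peel the pair `s(ℓ, c)`
      by_cases hcd : c = d
      · subst hcd
        exact fingerML3_peel_pair_self w A N c b ℓ hNA hd hℓ hsub
      · exact fingerML3_peel_pair w A N d c b ℓ hNA hd hc (Ne.symm hcd) hℓ (wle c hc) hsub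

end FingerLeaves

end

end Summit.CriticalPhenomena.PercolationContinuityZ3.Theorems
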